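import Summits.QuantumFields.YangMills.Theorems.IR.AfPincerUcSharpOnsetSuppliers
import Summits.QuantumFields.YangMills.Theorems.IR.BlockedActivityTyp
import HarnessLib

/-!
# Crux `IR` (stmt-QuantumFields-19354), lane B «strong coupling AFTER BLOCKING»: the Typ-relativised class ON THE LEAD'S WORKING CLASS —
# cplan (6d-wc) instantiated (owner R95: «DEDUP: consume the LEAD's clause (ii)∕(iii) side, never clause (i)»)

Helper module for item `stmt-QuantumFields-19354` (`--supports`; it closes nothing), lane `ym-19354-onsetsc-p2`.  Lane A (LEAD af-pincer)
supplies the rarity side of format Uc for the frame-covariant cell-local WORKING CLASS `IRTypLocalExcess.WorkingClass` as the explicit inequality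
`workingBudget ≤ δ` (`SupCellRarityAt`, p518433 ∕ p519656); cplan's (6d-wc) `SharpOnset.ir_of_activitySupplierSharpSC` (p532802) composes ANY
per-frame activity predicate `Act` with an adapter `Act → ClauseI` and that rarity into `IR|SC` with no X-stub.  Here `Act := BlockedActivityTyp`
(`Theorems/IR/BlockedActivityTyp`, p532761) at the total radius `radiusT ε`:

* `clauseI_of_blockedActivityTyp_radiusT` — the single-frame adapter with no side condition on `ε`;
* `BlockedActivityWorkingClassCalSC` — the lane-B construction statement ON THE WORKING CLASS: on the SC family, for every `(G, r)` and NT unit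
  map `a`, some admissible `(n, ε)` such that for every `δ > 0`, at all large `β`, a calibrated mesh `b(β)` (`a β · b < T`) and working-class
  parameters `(ℓ, T', Rs, E)` with, on every mesh-`b` frame `w`, the blocked representation of radius `radiusT ε` RELATIVE to
  `WorkingClass r.ρ ℓ T' Rs E w`-data and the any-exterior single-cell rarity `SupCellRarityAt … δ`;
* **`ir_of_blockedActivityWorkingClassCalSC : BlockedActivityWorkingClassCalSC → SharpOnset.IRNSC → Theses.BalabanLadder.IR`** ((6d-wc) instantiated).
So the two lanes meet in the kernel: lane A's working class carries (ii)(iii); lane B's blocked representation relative to it carries (i).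

HONEST FRAMING: a reduction among OPEN statements of a CONDITIONAL chain; whether the working class at a calibrated mesh admits a blocked
representation of radius `radiusT ε` is the research content (no source); not a gap, not Clay.  No `sorry`; axioms ⊆ {propext,
Classical.choice, Quot.sound}.
-/

set_option autoImplicit false

noncomputable section

open Filter Topology MeasureTheory
open Literature.MathematicalPhysics.QuantumFieldTheory Literature.MathematicalPhysics.QuantumLattice
open Summit.QuantumFields.YangMills.Cruxes.OSLegsFromFemtoAndGap.DlrCollarTransfer (LowerBounds)
open Summit.QuantumFields.YangMills.Cruxes.IR.OnsetFormats (shellCount)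
open Summit.QuantumFields.YangMills.Cruxes.IR.FixedMesh (ClauseI)
open Summit.QuantumFields.YangMills.Theorems.IRTypLocalExcess (WorkingClass)
open Summit.QuantumFields.YangMills.Cruxes.IR.AfPincerUc.Supplier (SupCellRarityAt)
open Summit.QuantumFields.YangMills.Cruxes.IR.AfPincerUc.SharpOnset (IRNSC ir_of_activitySupplierSharpSC)

namespace Summit.QuantumFields.YangMills.Cruxes.IR.BlockedActivity

section Adapter

variable {G : Type} [Group G] [TopologicalSpace G] [IsTopologicalGroup G] [CompactSpace G]
  [MeasurableSpace G] [BorelSpace G] {N : ℕ} {ρ : G →* Matrix (Fin N) (Fin N) ℂ} {β : ℝ}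
  {w : Fin 4 → ℤ → ℤ} {ε : ℝ}

/-- **Single-frame adapter, total form**: `BlockedActivityTyp ρ β w n (radiusT ε) Typ → ClauseI ρ β w n ε Typ` (no side condition on `ε`). -/
theorem clauseI_of_blockedActivityTyp_radiusT {n : ℕ} {Typ : Cell → Set (LGConfig 4 G)}
    (hC : BlockedActivityTyp ρ β w n (radiusT ε) Typ) : ClauseI ρ β w n ε Typ :=
  clauseI_mono (min_le_left ε 1) (clauseI_of_blockedActivityTyp hC (min_le_right ε 1) le_rfl)

end Adapter

/-- **Lane B on the LEAD's working class, NT-calibrated** — the `hcons` of cplan's (6d-wc) `SharpOnset.ir_of_activitySupplierSharpSC` with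
`Act := BlockedActivityTyp`, `r₀ n ε := radiusT ε`.  OPEN research content; not asserted. -/
def BlockedActivityWorkingClassCalSC : Prop :=
  ∀ (G : Type) [Group G] [TopologicalSpace G] [IsTopologicalGroup G] [CompactSpace G],
    IsCompactSimpleLieGroup G → SimplyConnectedSpace G →
    letI : MeasurableSpace G := borel G; haveI : BorelSpace G := ⟨rfl⟩;
    ∀ (r : LatticeRep G) (a : ℝ → ℝ), (∀ β, 0 < a β) → Tendsto a atTop (𝓝 0) → LowerBounds G r a →
      ∃ (n : ℕ) (ε : ℝ), 1 ≤ n ∧ 0 ≤ ε ∧ ε * shellCount n ≤ 3 / 4 ∧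
        ∀ δ : ℝ, 0 < δ → ∃ T β₂ : ℝ, ∀ β : ℝ, β₂ ≤ β → ∃ b : ℕ, 1 ≤ b ∧ a β * (b : ℝ) < T ∧
          ∃ (ℓ : ℕ) (T' : ℝ) (Rs : Set ℕ) (E : ℕ → ℝ), ∀ w : Fin 4 → ℤ → ℤ, OnsetFormatsUc.IsFrame b w →
            BlockedActivityTyp r.ρ β w n (radiusT ε) (WorkingClass r.ρ ℓ T' Rs E w) ∧
              SupCellRarityAt r.ρ β w (WorkingClass r.ρ ℓ T' Rs E w) δ

/-- **Lane B on the working class ∧ R_NSC ⇒ the route decl `IR`, NO X-stub** (cplan (6d-wc) instantiated; lane A's rarity side, lane B's clause (i)). -/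
theorem ir_of_blockedActivityWorkingClassCalSC (h : BlockedActivityWorkingClassCalSC) (hN : IRNSC) :
    Summit.QuantumFields.YangMills.Theses.BalabanLadder.IR :=
  ir_of_activitySupplierSharpSC (Act := @BlockedActivityTyp) (r₀ := fun _ ε => radiusT ε)
    (hadapt := fun _ _ _ _ _ _ hA => clauseI_of_blockedActivityTyp_radiusT hA) h hN

end Summit.QuantumFields.YangMills.Cruxes.IR.BlockedActivity

end
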